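import Summits.CriticalPhenomena.PercolationContinuityZ3.Theorems.PercNearOneGluingNoHeavyLowerTailSahiHittingAnyIndex
import Summits.CriticalPhenomena.PercolationContinuityZ3.Theorems.PercNearOneGluingNoHeavyLowerTailSahiE3HittingPercolation
import HarnessLib

/-!
# `NoHeavyLowerTail` (stmt-CriticalPhenomena-4575) — bond percolation on ANY graph: "some edge of `F_i` open / closed" at EVERY order
# for families of edge sets of width ≤ 3

Support file, seat `prim-l12-p5` (gen 7), `--supports stmt-CriticalPhenomena-4575`.  No definitions, no named facts, no sorries, standard axioms.

The percolation phrasing of `…SahiHittingAnyIndex` (any index type, width ≤ 3, every order), in the style of the order-3/4 files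
`…SahiE3HittingPercolation` / `…SahiE4HittingPercolation` of gen 6:

* `msahiE_prodBernoulli_someClosed_eq_sahiE` — the finite-coordinate bridge for the DECREASING events `{ω | ∃ a ∈ A_l, a ∉ ω}`
  ("some coordinate of `A_l` closed"), and `msahiE_prodBernoulli_someClosed_nonneg_of_width_le_three` (any `ι`, every order).
* `setBernoulli_msahiE_hit_nonneg_of_width_le_three` / `…someClosed…` — Mathlib's homogeneous `setBer(u, p)`.
* **`msahiE_bondPercolation_someOpen_nonneg_of_width_le_three`** / **`…someClosed…`**: for bond percolation `P_p` on ANY graph `G` and finite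
  edge sets `F : Fin m → Finset (Sym2 V)` such that among any four indices two carry nested edge sets, the events "some edge of `F_l` is open"
  (resp. "some edge of `F_l` is closed") satisfy `E_m ≥ 0` at every order `m`; in particular any three finite edge sets with arbitrary
  multiplicities (`…_of_three_sets`).
-/

noncomputable section

namespace Summit.CriticalPhenomena.PercolationContinuityZ3.Theorems

namespace SahiHitting

open MeasureTheory ProbabilityTheory Finset Function Literature.Combinatorics.Sahi2008
open Literature.Probability.Percolation (prodBernoulli_map_preimage bondPercolation BondConfig)
open Literature.Probability.Percolation.BHK2006 (integral_prodBernoulli_eq_sum)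
open Literature.Probability.Percolation.DecisionTree (ind ind_of_mem ind_of_not_mem ind_nonneg)
open Literature.Probability.LatticeModels (prodBernoulli prodBernoulli_indicator_holds)

variable {ι : Type*}

section Bridge

variable [DecidableEq ι]

/-- The event "some coordinate of `A ⊆ K` is closed" in `2^ι` is the pull-back, under restriction to `K`, of the same event read in `2^K`.
[folklore] -/
theorem ind_someClosed_eq_ind_someClosed_restrict (K : Finset ι) (A : Finset ι) (hA : A ⊆ K) (S : Set ι) :
    ind {ω : Set ι | ∃ a ∈ A, a ∉ ω} S
      = ind {ω : Set K | ∃ a ∈ A.subtype (· ∈ K), a ∉ ω} ((Subtype.val : K → ι) ⁻¹' S) := by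
  by_cases h : ∃ a ∈ A, a ∉ S
  · obtain ⟨a, ha, haS⟩ := h
    rw [ind_of_mem (show S ∈ {ω : Set ι | ∃ a ∈ A, a ∉ ω} from ⟨a, ha, haS⟩),
      ind_of_mem (show (Subtype.val : K → ι) ⁻¹' S ∈ {ω : Set K | ∃ a ∈ A.subtype (· ∈ K), a ∉ ω} from
        ⟨⟨a, hA ha⟩, by simpa [Finset.mem_subtype] using ha, by simpa using haS⟩)]
  · rw [ind_of_not_mem (show S ∉ {ω : Set ι | ∃ a ∈ A, a ∉ ω} from h),
      ind_of_not_mem (show (Subtype.val : K → ι) ⁻¹' S ∉ {ω : Set K | ∃ a ∈ A.subtype (· ∈ K), a ∉ ω} from by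
        rintro ⟨a, ha, haS⟩
        exact h ⟨a, by simpa [Finset.mem_subtype] using ha, by simpa using haS⟩)]

/-- **Finite-coordinate bridge, decreasing events.**  For finite `A_l ⊆ K`, Sahi's functional of the events "some coordinate of `A_l` is
closed" under `prodBernoulli p` on `Set ι` (ANY `ι`) equals the finite functional of the same events inside `2^K` under the product weight
`p|_K`. [this work] -/
theorem msahiE_prodBernoulli_someClosed_eq_sahiE (p : ι → unitInterval) (K : Finset ι) (m : ℕ) (A : Fin m → Finset ι)
    (hA : ∀ l, A l ⊆ K) :
    msahiE (prodBernoulli p) m (fun l => ind {ω : Set ι | ∃ a ∈ A l, a ∉ ω})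
      = sahiE (bernoulliWeight (fun a : K => p a)) m
          (fun l => ind {ω : Set K | ∃ a ∈ (A l).subtype (· ∈ K), a ∉ ω}) := by
  classical
  set π : Set ι → Set K := fun S => (Subtype.val : K → ι) ⁻¹' S with hπ
  set g' : Fin m → Set K → ℝ := fun l => ind {ω : Set K | ∃ a ∈ (A l).subtype (· ∈ K), a ∉ ω} with hg'
  have hmeasπ : Measurable π := measurable_restrictToFinset K
  have hmap : (prodBernoulli p).map π = prodBernoulli (fun a : K => p a) :=
    prodBernoulli_map_preimage p Subtype.val_injective
  refine msahiE_eq_sahiE_of_moments _ _ _ g' fun S => ?_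
  have hcomp : (∏ i ∈ S, (fun l => ind {ω : Set ι | ∃ a ∈ A l, a ∉ ω}) i) = (∏ i ∈ S, g' i) ∘ π := by
    funext ω
    simp only [Finset.prod_apply, Function.comp_apply, hg']
    exact Finset.prod_congr rfl fun i _ => ind_someClosed_eq_ind_someClosed_restrict K (A i) (hA i) ω
  rw [hcomp]
  have h1 : ∫ x, ((∏ i ∈ S, g' i) ∘ π) x ∂(prodBernoulli p) = ∫ y, (∏ i ∈ S, g' i) y ∂((prodBernoulli p).map π) := by
    rw [integral_map hmeasπ.aemeasurable (Measurable.of_discrete.aestronglyMeasurable)]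
    rfl
  rw [h1, hmap, integral_prodBernoulli_eq_sum]
  rfl

end Bridge

/-- **Decreasing form, width ≤ 3, ANY product space, every order.**  For finite sets `A : Fin m → Finset ι` such that any four indices
contain a nested pair, the events `{ω | ∃ a ∈ A_l, a ∉ ω}` ("some coordinate of `A_l` is closed") satisfy
`0 ≤ E_m^{prodBernoulli q}`. [this work] -/
theorem msahiE_prodBernoulli_someClosed_nonneg_of_width_le_three (q : ι → unitInterval) (m : ℕ) (A : Fin m → Finset ι)
    (hw : ∀ S : Finset (Fin m), S.card = 4 → ∃ i ∈ S, ∃ j ∈ S, i ≠ j ∧ A i ⊆ A j) :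
    0 ≤ msahiE (prodBernoulli q) m (fun l => ind {ω : Set ι | ∃ a ∈ A l, a ∉ ω}) := by
  classical
  let K : Finset ι := Finset.univ.biUnion A
  have hA : ∀ l, A l ⊆ K := fun l => Finset.subset_biUnion_of_mem A (Finset.mem_univ l)
  rw [msahiE_prodBernoulli_someClosed_eq_sahiE q K m A hA]
  refine prodBernoulli_sahiE_someClosed_nonneg_of_width_le_three _ m _ fun S hS => ?_
  obtain ⟨i, hi, j, hj, hij, hsub⟩ := hw S hS
  exact ⟨i, hi, j, hj, hij, subtype_subset_subtype_of_subset hsub⟩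

/-! ### Mathlib's homogeneous `setBer(u, p)` -/

/-- **`setBer(u, p)` form, hitting events, width ≤ 3, every order.** [this work; cite: Grimmett1999, §1.3] -/
theorem setBernoulli_msahiE_hit_nonneg_of_width_le_three (u : Set ι) (p : unitInterval) (m : ℕ) (A : Fin m → Finset ι)
    (hw : ∀ S : Finset (Fin m), S.card = 4 → ∃ i ∈ S, ∃ j ∈ S, i ≠ j ∧ A i ⊆ A j) :
    0 ≤ msahiE setBer(u, p) m (fun l => ind {ω : Set ι | ∃ a ∈ A l, a ∈ ω}) := by
  classical
  rw [← prodBernoulli_indicator_holds u p]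
  exact msahiE_prodBernoulli_hit_nonneg_of_width_le_three _ m A hw

/-- **`setBer(u, p)` form, "some coordinate closed", width ≤ 3, every order.** [this work; cite: Grimmett1999, §1.3] -/
theorem setBernoulli_msahiE_someClosed_nonneg_of_width_le_three (u : Set ι) (p : unitInterval) (m : ℕ) (A : Fin m → Finset ι)
    (hw : ∀ S : Finset (Fin m), S.card = 4 → ∃ i ∈ S, ∃ j ∈ S, i ≠ j ∧ A i ⊆ A j) :
    0 ≤ msahiE setBer(u, p) m (fun l => ind {ω : Set ι | ∃ a ∈ A l, a ∉ ω}) := by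
  classical
  rw [← prodBernoulli_indicator_holds u p]
  exact msahiE_prodBernoulli_someClosed_nonneg_of_width_le_three _ m A hw

/-! ### Bond percolation on any graph -/

variable {V : Type*}

/-- **Bond percolation on ANY graph, every order: `0 ≤ E_m({some edge of F_l open}_l)`** for finite edge sets `F : Fin m → Finset (Sym2 V)`
such that among any four indices two carry nested edge sets, under `P_p = bondPercolation G p`.
[this work; cite: Kahn2022, Conj. 5 (arXiv p. 3); Grimmett1999, §1.3] -/
theorem msahiE_bondPercolation_someOpen_nonneg_of_width_le_three (G : SimpleGraph V) (p : unitInterval) (m : ℕ)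
    (F : Fin m → Finset (Sym2 V)) (hw : ∀ S : Finset (Fin m), S.card = 4 → ∃ i ∈ S, ∃ j ∈ S, i ≠ j ∧ F i ⊆ F j) :
    0 ≤ msahiE (bondPercolation G p) m (fun l => ind {ω : BondConfig V | ∃ e ∈ F l, e ∈ ω}) := by
  unfold bondPercolation
  exact setBernoulli_msahiE_hit_nonneg_of_width_le_three _ p m F hw

/-- **Bond percolation on ANY graph, every order, decreasing form: `0 ≤ E_m({some edge of F_l closed}_l)`** for finite edge sets of
width ≤ 3 under `P_p`. [this work; cite: Kahn2022, Conj. 5 (arXiv p. 3); GrimmettPercolation1999, §11.2] -/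
theorem msahiE_bondPercolation_someClosed_nonneg_of_width_le_three (G : SimpleGraph V) (p : unitInterval) (m : ℕ)
    (F : Fin m → Finset (Sym2 V)) (hw : ∀ S : Finset (Fin m), S.card = 4 → ∃ i ∈ S, ∃ j ∈ S, i ≠ j ∧ F i ⊆ F j) :
    0 ≤ msahiE (bondPercolation G p) m (fun l => ind {ω : BondConfig V | ∃ e ∈ F l, e ∉ ω}) := by
  unfold bondPercolation
  exact setBernoulli_msahiE_someClosed_nonneg_of_width_le_three _ p m F hw

/-- **Three finite edge sets, arbitrary multiplicities, every order**: for `B : Fin 3 → Finset (Sym2 V)` and any `c : Fin m → Fin 3`,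
`0 ≤ E_m({some edge of B_{c l} open}_l)` under bond percolation on any graph — Sahi's generating-function conjecture for the three
events "some edge of `B_i` is open". [this work; cite: Kahn2022, Conj. 5 (arXiv p. 3)] -/
theorem msahiE_bondPercolation_someOpen_nonneg_of_three_sets (G : SimpleGraph V) (p : unitInterval) (B : Fin 3 → Finset (Sym2 V))
    (m : ℕ) (c : Fin m → Fin 3) :
    0 ≤ msahiE (bondPercolation G p) m (fun l => ind {ω : BondConfig V | ∃ e ∈ B (c l), e ∈ ω}) := by
  refine msahiE_bondPercolation_someOpen_nonneg_of_width_le_three G p m (fun l => B (c l)) fun S hS => ?_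
  have hlt : (Finset.univ : Finset (Fin 3)).card < S.card := by simp [hS]
  obtain ⟨i, hi, j, hj, hij, hc⟩ := Finset.exists_ne_map_eq_of_card_lt_of_maps_to hlt (f := c) fun _ _ => Finset.mem_univ _
  exact ⟨i, hi, j, hj, hij, by simp [hc]⟩

end SahiHitting

end Summit.CriticalPhenomena.PercolationContinuityZ3.Theorems
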